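import Summits.BirchSwinnertonDyer.Rank1Residual.Additive.X4TamDefectAdditivePrime
import Summits.BirchSwinnertonDyer.Rank1Residual.X4.IharaSurjOfThreeLevel
import HarnessLib

/-!
# The two PRINTED inputs behind `IharaSurjectiveAtAdditive`: the three-level Ihara lemma (curve-free) and the support annihilator (Carayol–Livné) (cell `b2b-bsdres`, seat additive-p4, line V48)

HONEST FRAMING (verbatim, cell `b2b-bsdres`): the goal of the cell is to DELETE the COMBINATION-SHAPED
residual classes for ALL analytic-rank `≤ 1` curves over `ℚ` — "full BSD formula for every rank `≤ 1`
curve in class `C`" assembled STRICTLY from published theorems — so that the rank-`≤ 1` remainder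
becomes exactly the CONSTRUCTION-SHAPED classes, which are TYPED (missing-input Props), NOT attempted;
this is not "finishing BSD". This file: a research-route file of the CLASS-CLOSURE lane (class N11
TAM-DEFECT₂(3), sub-class NL): TWO typed statements (`@[conjecture] def`, asserting nothing) that
FACTOR the typed target `IharaSurjectiveAtAdditive` of `Additive/X4TamDefectAdditivePrime` into
its two printed ingredients, and the kernel theorem composing them (via
`X4/IharaSurjOfThreeLevel.surjAt_of_iharaThree_of_annihilator`). Nothing booked; X4 stays
CONSTRUCTION-SHAPED; no Literature fact (neither ingredient is held in citable `Γ₀` form).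

* `IharaLemmaThreeLevel` — CURVE-FREE: for `M = M′ℓ` with `ℓ ∤ M′` and every maximal ideal `𝔫` of
  `𝕋̃ = ℤ[T_r : r ∤ Mℓ]` with `2 ∉ 𝔫`, `ℓ ∉ 𝔫`, not Eisenstein, some `s ∉ 𝔫` lifts every pair of
  level-`M` cycles `(x, y)` with `β′_* x = α′_* y` to a level-`Mℓ` cycle over `(s x, s y)` — the
  middle exactness of `H₁(X₀(M′ℓ²)) → H₁(X₀(M′ℓ))² → H₁(X₀(M′))` after localisation at `𝔫`
  (Wiles 1995 Lemma 2.5 / (2.13) = Darmon–Diamond–Taylor Lemma 4.28 (b), printed for `Y₁(M′ℓ, ℓ²)` with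
  `ℤ_q`-coefficients, `q` odd, `q ≠ ℓ`; with Lemma 4.30 for `X₁(M′, ℓ^k)` at non-Eisenstein `𝔫`,
  p. 137; the `Γ₀` version "supported only at Eisenstein maximal ideals" is Diamond–Ribet 1997 §4.4).
  The binders `2 ∉ 𝔫`, `ℓ ∉ 𝔫` are the printed ones (`q` odd, `q ≠ ℓ`). This is the statement V47
  wanted as a Literature fact; it is typed here because no held source prints the `Γ₀` form.
* `SupportAnnihilatorAtAdditive W p M′ ℓ f` — ROW-LOCAL: for the NL row data (additive `ℓ`,
  `3 ∣ c_ℓ`, …) and every maximal `𝔫 ∋ p, T_r − a_r(W)`, some `s₁ ∉ 𝔫` kills both push-forwards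
  `H₁(X₀(M), ℤ) → H₁(X₀(M′), ℤ)` — "`𝔫` is not in the support of the level-`M′ = N/ℓ²` homology".
  In print as the conjunction of (a) Carayol 1986 / Livné 1989: the prime-to-`p` Artin conductor of
  `ρ̄_g` divides the level of `g` (Edixhoven 1997, §1, "it follows easily that `N(ρ_f)` divides `N`"),
  and (b) `ρ̄ = W[3]` IS ramified at `ℓ` (inertia the tame `C₃`, unipotent non-trivial mod `3`:
  module docstring of `Additive/X4TamDefectAdditivePrime`), so no eigenform of level `M′`
  (`ℓ ∤ M′`) is congruent to `f`; the tree has no mod-`p` Galois representation attached to a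
  Hecke eigensystem at `ℓ ∥ M`, hence a TARGET. Decided per row by the seat's instrument E6
  (`supp_prime_to_l = 0` on every row computed).
* `iharaSurjectiveAtAdditive_of_threeLevel_of_support`: the two statements (with the numerals
  `M′ℓ = M`, `ℓ ∤ M′`) IMPLY `IharaSurjectiveAtAdditive W p ℓ f`.

## References

* H. Darmon, F. Diamond, R. Taylor, *Fermat's Last Theorem* (1995), Lemma 4.28 (b), Lemma 4.30, §4.5 p. 137. [cite: DarmonDiamondTaylor1995, Lemma 4.28 (a)–(b), Lemma 4.30 (a)–(b), §4.5 pp. 135–137]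
* F. Diamond, K. Ribet, in Cornell–Silverman–Stevens (1997), §4.4 (10)–(11), Lemma 4.6. [cite: DiamondRibet1997, §4.4 Lemma 4.6]
* H. Carayol, Ann. Sci. ÉNS 19 (1986) 409–468, Théorème (A); B. Edixhoven in Cornell–Silverman–Stevens (1997) §1 p. 224. [cite: CarayolASENS1986, Théorème (A), pp. 410–411] [cite: Edixhoven1997, §1 p. 224]
* A. Wiles, Ann. of Math. 141 (1995), Lemma 2.5 p. 493, (2.13) p. 494, pp. 494–495. [cite: Wiles1995Annals, Lemma 2.5 p. 493; (2.13) p. 494; pp. 494–495 (J_H, three-copy form)]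
-/

noncomputable section

open scoped MatrixGroups ModularForm Classical

open CongruenceSubgroup

open Literature.NumberTheory.EllipticCurves Literature.NumberTheory.EllipticCurves.ModularForms

namespace Summit.BirchSwinnertonDyer.Rank1Residual.LevelLowering

/-! ### §1 The two typed ingredients -/

section Targets

/-- **THE THREE-LEVEL IHARA LEMMA FOR `Γ₀`, LOCALISED (typed statement; curve-free).** For
`M = M′ℓ` with `ℓ ∤ M′` prime, `𝕋̃ = ℤ[T_r : r ∤ Mℓ]` (level-`M` operators,
`HeckeRing0.primeTo M 2 (Mℓ)`), and every maximal ideal `𝔫 ⊂ 𝕋̃` with `2 ∉ 𝔫`, `ℓ ∉ 𝔫`, NOT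
Eisenstein: some `s ∈ 𝕋̃ ∖ 𝔫` such that every pair of cycles `x, y ∈ H₁(X₀(M), ℤ)` with
`β′_* x = α′_* y` (`α′ = [1], β′ = [ℓ] : S₂(Γ₀(M′)) → S₂(Γ₀(M))`) lifts to a cycle
`z ∈ H₁(X₀(Mℓ), ℤ)` with `α_* z = s x`, `β_* z = s y` — the localisation at `𝔫` of
`H₁(X₀(M′ℓ²)) → H₁(X₀(M′ℓ))² → H₁(X₀(M′))` is exact in the middle. STATUS: a THEOREM in print for
the curves `Y₁(M′ℓ, ℓ²) → Y₁(M′ℓ)² → Y₁(M′)` with `ℤ_q`-coefficients, `q` odd, `q ≠ ℓ`, `M′ > 3`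
(Wiles 1995 (2.13) = Darmon–Diamond–Taylor Lemma 4.28 (b)), for `X₁(M′, ℓ^k)` after localisation at
a non-Eisenstein `𝔫` (Wiles Lemma 2.5 p. 493; DDT p. 137 with Lemma 4.30), and for `Γ_H ⊇ Γ₀` in the
THREE-COPY form after the same localisation (Wiles pp. 494–495; DDT p. 137, last display); the `Γ₀`
middle-exactness is asserted in Diamond–Ribet 1997 §4.4 ("the cokernel is supported only at
Eisenstein maximal ideals"). The printed binders `N > 3` (DDT 4.28 (b)) / `N_Σ > 3p` (DR 4.6) are
dropped here: Wiles p. 494 removes them after the localisation. The pure-`Γ₀` two-step form is not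
displayed verbatim in the held sources, hence TYPED, not a Literature fact. Nothing asserted.
[cite: Wiles1995Annals, Lemma 2.5 p. 493; (2.13) p. 494; pp. 494–495 (J_H, three-copy form)]
[cite: DarmonDiamondTaylor1995, Lemma 4.28 (a)–(b), Lemma 4.30 (a)–(b), §4.5 pp. 135–137]
[cite: DiamondRibet1997, §4.4 Lemma 4.6] -/
@[conjecture] def IharaLemmaThreeLevel : Prop :=
  ∀ (M' M : ℕ) [NeZero M'] [NeZero M] (ℓ : ℕ) [Fact ℓ.Prime], M' * ℓ = M → ¬ ℓ ∣ M' →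
    ∀ 𝔫 : Ideal (HeckeRing0.primeTo M 2 (M * ℓ)), 𝔫.IsMaximal →
      (2 : HeckeRing0.primeTo M 2 (M * ℓ)) ∉ 𝔫 →
      ((ℓ : ℕ) : HeckeRing0.primeTo M 2 (M * ℓ)) ∉ 𝔫 →
      ¬ HeckeRing0.primeTo.IsEisenstein 𝔫 →
      ∃ s : HeckeRing0.primeTo M 2 (M * ℓ), s ∉ 𝔫 ∧
        ∀ x ∈ periodHomology M, ∀ y ∈ periodHomology M,
          (degeneracyMap0 M' M ℓ 2).dualMap x = (degeneracyMap0 M' M 1 2).dualMap y →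
          ∃ z ∈ periodHomology (M * ℓ),
            (degeneracyMap0 M (M * ℓ) 1 2).dualMap z = (s : HeckeRing0 M 2) • x ∧
            (degeneracyMap0 M (M * ℓ) ℓ 2).dualMap z = (s : HeckeRing0 M 2) • y

variable (W : WeierstrassCurve ℚ) [W.IsGloballyMinimal] (p : ℕ) [Fact p.Prime]
  (M' : ℕ) [NeZero M'] {M : ℕ} [NeZero M] (ℓ : ℕ) [Fact ℓ.Prime] (f : CuspForm (Gamma0 (M * ℓ)) 2)

/-- **THE SUPPORT ANNIHILATOR AT AN ADDITIVE DEFECT PRIME (typed target; row-local).** Row data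
as in `MazurPrincipleNewVanishingAdditive` (newform `f` of `W` at `N = Mℓ`, `p` odd, `W[p]`
irreducible, `ℓ ≠ p`, `ℓ ∣ M`, `ℓ` additive with `p ∣ c_ℓ` — forcing `p = 3`, type IV/IV*), and
`M′ℓ = M`. Then for every maximal `𝔫 ⊂ 𝕋̃` containing `p` and all `T_r − a_r(W)` (`r ∤ Mℓ`) some
`s₁ ∈ 𝕋̃ ∖ 𝔫` kills both push-forwards of level-`M` cycles to level `M′`:
`β′_*(s₁ x) = 0 = α′_*(s₁ x)` — `𝔫` is not in the support of `H₁(X₀(M′), ℤ)`. STATUS: in print as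
(Carayol 1986 Thm. (A) / Livné 1989: the prime-to-`p` conductor of `ρ̄_g` divides the level of `g`;
Edixhoven 1997 §1 "it follows easily that `N(ρ_f)` divides `N`") + (the ramification of `ρ̄ = W[3]`
at `ℓ`: tame inertia `C₃`, unipotent non-trivial mod `3`), which together say that no eigenform of
level `M′` (`ℓ ∤ M′`) is congruent to `f` outside `Mℓ`; not typable in the tree (no mod-`p` Galois
representation attached to a Hecke eigensystem at level `M`), hence a TARGET. Decided per row by the
seat's instrument E6 (EVIDENCE). Nothing asserted. [cite: CarayolASENS1986, Théorème (A), pp. 410–411]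
[cite: Edixhoven1997, §1 p. 224] [cite: DiamondRibet1997, §4.4 Lemma 4.6] -/
@[conjecture] def SupportAnnihilatorAtAdditive : Prop :=
  IsNewformOf W f → W.conductorNorm ℤ = M * ℓ → p ≠ 2 → W.HasIrreducibleModPGaloisRep p →
    ℓ ≠ p → ℓ ∣ M → (ℓ : ℤ) ∣ W.minimalDiscriminantInt →
    (ℓ : ℤ) ∣ (WeierstrassCurve.integralModelInt W).c₄ →
    p ∣ (W.baseChange ℚ_[ℓ]).localTamagawaNumber ℤ_[ℓ] → M' * ℓ = M →
    ∀ 𝔫 : Ideal (HeckeRing0.primeTo M 2 (M * ℓ)), 𝔫.IsMaximal →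
      (p : HeckeRing0.primeTo M 2 (M * ℓ)) ∈ 𝔫 →
      (∀ (r : ℕ) (hr : r.Prime) (hrS : ¬ r ∣ M * ℓ),
        HeckeRing0.primeTo.T M 2 (M * ℓ) hr hrS -
          ((W.LFunction r : ℤ) : HeckeRing0.primeTo M 2 (M * ℓ)) ∈ 𝔫) →
      ∃ s₁ : HeckeRing0.primeTo M 2 (M * ℓ), s₁ ∉ 𝔫 ∧
        ∀ x ∈ periodHomology M,
          (degeneracyMap0 M' M ℓ 2).dualMap ((s₁ : HeckeRing0 M 2) • x) = 0 ∧
          (degeneracyMap0 M' M 1 2).dualMap ((s₁ : HeckeRing0 M 2) • x) = 0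

end Targets

/-! ### §2 The composition -/

section Compose

/-- If an ideal contains the images of two coprime naturals, it contains `1`. [folklore] -/
private theorem one_mem_of_coprime_natCast_mem {R : Type*} [CommRing R] {I : Ideal R} {a b : ℕ}
    (h : Nat.Coprime a b) (ha : (a : R) ∈ I) (hb : (b : R) ∈ I) : (1 : R) ∈ I := by
  obtain ⟨u, v, huv⟩ := Nat.isCoprime_iff_coprime.mpr h
  have e : ((u * a + v * b : ℤ) : R) = 1 := by rw [huv, Int.cast_one]
  rw [← e]
  push_cast
  exact I.add_mem (I.mul_mem_left _ ha) (I.mul_mem_left _ hb)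

variable {W : WeierstrassCurve ℚ} [W.IsGloballyMinimal] {p : ℕ} [hp : Fact p.Prime]
  {M' : ℕ} [NeZero M'] {M : ℕ} [NeZero M] {ℓ : ℕ} [hℓ : Fact ℓ.Prime] {f : CuspForm (Gamma0 (M * ℓ)) 2}

/-- **(IS) ⟸ THREE-LEVEL IHARA + SUPPORT ANNIHILATOR** (numerals `M′ℓ = M`, `ℓ ∤ M′`): the typed
target `IharaSurjectiveAtAdditive W p ℓ f` follows from `IharaLemmaThreeLevel` and
`SupportAnnihilatorAtAdditive W p M′ ℓ f` by `surjAt_of_iharaThree_of_annihilator` (`t = s s₁`);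
the printed binders `2 ∉ 𝔫`, `ℓ ∉ 𝔫` hold because `p ∈ 𝔫` with `p` an odd prime `≠ ℓ` and `𝔫`
proper. [cite: DiamondRibet1997, §4.4 Lemma 4.6]
[cite: DarmonDiamondTaylor1995, Lemma 4.28 (a)–(b), Lemma 4.30 (a)–(b), §4.5 pp. 135–137] -/
theorem iharaSurjectiveAtAdditive_of_threeLevel_of_support (hI3 : IharaLemmaThreeLevel)
    (hsupp : SupportAnnihilatorAtAdditive W p M' ℓ f) (hM : M' * ℓ = M) (hℓM' : ¬ ℓ ∣ M') :
    IharaSurjectiveAtAdditive W p ℓ f := by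
  intro hf hN hp2 hirr hℓp hℓM hΔ hc₄ hcℓ 𝔫 h𝔫 hp𝔫 hT hE
  have h1 : (1 : HeckeRing0.primeTo M 2 (M * ℓ)) ∉ 𝔫 := fun h ↦
    h𝔫.ne_top ((Ideal.eq_top_iff_one 𝔫).mpr h)
  have h2 : (2 : HeckeRing0.primeTo M 2 (M * ℓ)) ∉ 𝔫 := by
    intro h2
    refine h1 (one_mem_of_coprime_natCast_mem (a := 2) (b := p) ?_ (by exact_mod_cast h2) hp𝔫)
    exact (Nat.coprime_primes Nat.prime_two hp.out).mpr (Ne.symm hp2)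
  have hℓ𝔫 : ((ℓ : ℕ) : HeckeRing0.primeTo M 2 (M * ℓ)) ∉ 𝔫 := by
    intro hℓ𝔫
    refine h1 (one_mem_of_coprime_natCast_mem (a := ℓ) (b := p) ?_ hℓ𝔫 hp𝔫)
    exact (Nat.coprime_primes hℓ.out hp.out).mpr hℓp
  obtain ⟨s, hs, h3⟩ := hI3 M' M ℓ hM hℓM' 𝔫 h𝔫 h2 hℓ𝔫 hE
  obtain ⟨s₁, hs₁, hann⟩ := hsupp hf hN hp2 hirr hℓp hℓM hΔ hc₄ hcℓ hM 𝔫 h𝔫 hp𝔫 hT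
  exact surjAt_of_iharaThree_of_annihilator 𝔫 h𝔫.isPrime hs h3 hs₁ hann

end Compose

end Summit.BirchSwinnertonDyer.Rank1Residual.LevelLowering

end
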